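import Mathlib
import Literature.Computability.Complexity.ExtMonotoneGRankSupport
import Summits.PneNP.PneNP.Theorems.CliqueExtLowerBound.Negative.LoadBearing
import Summits.PneNP.PneNP.Theorems.ConvexRankGatesCliqueExtLowerBoundGRankFiniteField
import Summits.PneNP.PneNP.Theorems.ConvexRankGatesLinAlgGateBlindDetCompress

/-!
# Route ConvexRankGates, crux `CliqueExtLowerBound` (stmt-PneNP-10682): GRANK gates live over the fields `𝔽̄_p`

Support file (`--supports stmt-PneNP-10682`, registered sub-goal `grankGate_iff_algClosureZMod` of the line
`width-threshold-certificate-sparsity`, lead c11); sequel of `…GRankFiniteField.lean` (p148191: every GRANK gate is a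
GRANK gate over a FINITE field). Pushing the finite-field data into an algebraic closure of its prime field along an
`𝔽_p`-embedding (`IsAlgClosed.lift`; base change does not change a GRANK gate, `le_rank_symbolicMatrix_map_iff` of
`…LinAlgGateBlindDetCompress.lean`) gives the sharper normal form

  `IsGRankGate s g ↔ ∃ p prime, ∃ d ≤ s, θ, K₀, Kᵢ ∈ 𝔽̄_p^{d×d}, ∀ v, g v = 1 ↔ θ ≤ rank (K₀ + ∑_{vᵢ=1} Xᵢ Kᵢ)`

(`isGRankGate_iff_algClosure_zmod`): the type-valued quantifier `∃ (F : Type) [Field F]` of the crux basis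
collapses to `∃ p : ℕ` — ONE canonical (algebraically closed, hence infinite: maximal-rank-of-a-pencil arguments
apply) field per prime, characteristic `0` never needed — and the crux is equivalent to the same lower bound over
that basis (`extGate_eq_algClosure_zmod`, `cliqueExtLowerBound_iff_algClosureZModBasis`). Complements
`exists_isAlgClosed_of_isGRankGate` and the per-characteristic amalgamation of `…LinAlgGateBlindCommonField.lean`
(crux #4): with both, all GRANK gates of a circuit of characteristic `p` may be taken over the single field `𝔽̄_p`.
No new definitions. [folklore]
-/

-- `Summit.PneNP.PneNP.…` duplicates `PneNP` BY DESIGN (single-problem summit).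
set_option linter.dupNamespace false

namespace Summit.PneNP.PneNP.Theorems.CliqueExtLowerBound.GRankPrimeField

open Literature.Computability.Complexity MvPolynomial Matrix
open Summit.PneNP.PneNP.Theorems.CliqueExtLowerBound.GRankFiniteField

/-- **GRANK data over any field are matched over `𝔽̄_p` for some prime `p`** (same dimension, threshold and
Boolean function): reduce to a finite field (`GRankFiniteField.exists_finite_field`), whose characteristic is a
prime `p`, and push the data into an algebraic closure of `𝔽_p` along an `𝔽_p`-embedding (base change does not
change a GRANK gate, `le_rank_symbolicMatrix_map_iff`). [folklore] -/
theorem exists_algClosure_zmod {F : Type*} [Field F] {n d : ℕ} (θ : ℕ) (K₀ : Matrix (Fin d) (Fin d) F)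
    (K : Fin n → Matrix (Fin d) (Fin d) F) :
    ∃ (p : ℕ) (_ : Fact p.Prime) (L₀ : Matrix (Fin d) (Fin d) (AlgebraicClosure (ZMod p)))
      (L : Fin n → Matrix (Fin d) (Fin d) (AlgebraicClosure (ZMod p))),
      ∀ v : Fin n → Bool, (θ ≤ (symbolicMatrix K₀ K v).rank ↔ θ ≤ (symbolicMatrix L₀ L v).rank) := by
  obtain ⟨κ, _, _, L₀, L, hL⟩ := exists_finite_field θ K₀ K
  obtain ⟨p, hp⟩ := CharP.exists κ
  have hp0 : p ≠ 0 := CharP.char_ne_zero_of_finite κ p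
  have hprime : p.Prime := (CharP.char_is_prime_or_zero κ p).resolve_right hp0
  haveI : Fact p.Prime := ⟨hprime⟩
  letI : Algebra (ZMod p) κ := ZMod.algebra κ p
  haveI : Module.Finite (ZMod p) κ := Module.Finite.of_finite
  haveI : Algebra.IsAlgebraic (ZMod p) κ := Algebra.IsAlgebraic.of_finite (ZMod p) κ
  let f : κ →+* AlgebraicClosure (ZMod p) :=
    (IsAlgClosed.lift (R := ZMod p) (M := AlgebraicClosure (ZMod p)) (S := κ)).toRingHom
  refine ⟨p, inferInstance, L₀.map f, fun i => (L i).map f, fun v => ?_⟩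
  rw [hL v, le_rank_symbolicMatrix_map_iff]

/-- **GRANK gates live over the fields `𝔽̄_p`.** `IsGRankGate s g` iff `g` is a generic-rank threshold gate of
dimension `≤ s` over the algebraic closure of `ZMod p` for some prime `p`: the type-valued quantifier
`∃ (F : Type) [Field F]` of the crux basis collapses to `∃ p prime` (a countable union of gate classes over ONE
canonical algebraically closed field per characteristic; characteristic `0` is never needed). [folklore] -/
theorem isGRankGate_iff_algClosure_zmod {s : ℕ} {g : GateFn} : IsGRankGate s g ↔
    ∃ (p : ℕ) (_ : Fact p.Prime) (d θ : ℕ), d ≤ s ∧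
      ∃ (K₀ : Matrix (Fin d) (Fin d) (AlgebraicClosure (ZMod p)))
        (K : Fin g.1 → Matrix (Fin d) (Fin d) (AlgebraicClosure (ZMod p))),
        ∀ v : Fin g.1 → Bool, g.2 v = true ↔ θ ≤ (symbolicMatrix K₀ K v).rank := by
  constructor
  · rintro ⟨F, _, d, θ, hd, K₀, K, hg⟩
    obtain ⟨p, _, L₀, L, hL⟩ := exists_algClosure_zmod θ K₀ K
    exact ⟨p, inferInstance, d, θ, hd, L₀, L, fun v => (hg v).trans (hL v)⟩
  · rintro ⟨p, _, d, θ, hd, K₀, K, hg⟩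
    exact ⟨AlgebraicClosure (ZMod p), inferInstance, d, θ, hd, K₀, K, hg⟩

/-- **The extended monotone basis with `𝔽̄_p`-GRANK gates**: `extGate s` with the GRANK disjunct read over the
fields `AlgebraicClosure (ZMod p)`, `p` prime. [folklore] -/
theorem extGate_eq_algClosure_zmod (s : ℕ) : extGate s =
    {GateFn.and 2, GateFn.or 2} ∪ {g | IsConvGate s g ∨ IsPermGate s g ∨
      ∃ (p : ℕ) (_ : Fact p.Prime) (d θ : ℕ), d ≤ s ∧
        ∃ (K₀ : Matrix (Fin d) (Fin d) (AlgebraicClosure (ZMod p)))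
          (K : Fin g.1 → Matrix (Fin d) (Fin d) (AlgebraicClosure (ZMod p))),
          ∀ v : Fin g.1 → Bool, g.2 v = true ↔ θ ≤ (symbolicMatrix K₀ K v).rank} := by
  ext g
  simp only [extGate, Set.mem_union, Set.mem_setOf_eq, isGRankGate_iff_algClosure_zmod]

open Filter Summit.PneNP.PneNP.Theorems.CliqueExtLowerBound.Negative in
open Classical in
/-- **The crux over the `𝔽̄_p` basis.** `CliqueExtLowerBound` is equivalent to the same lower bound for circuits
over `{∧₂, ∨₂} ∪ CONV_{m^c} ∪ PERM_{m^c} ∪ ⋃_p GRANK_{m^c}(𝔽̄_p)`. [folklore] -/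
theorem cliqueExtLowerBound_iff_algClosureZModBasis :
    Summit.PneNP.PneNP.Theses.ConvexRankGates.CliqueExtLowerBound ↔
    ∃ δ : ℝ, 0 < δ ∧ δ < 1 / 2 ∧ ∀ c : ℕ, ∀ᶠ m : ℕ in atTop,
      ∀ C : Circuit ((⊤ : SimpleGraph (Fin m)).edgeSet),
        C.IsOver ({GateFn.and 2, GateFn.or 2} ∪ {g | IsConvGate (m ^ c) g ∨ IsPermGate (m ^ c) g ∨
          ∃ (p : ℕ) (_ : Fact p.Prime) (d θ : ℕ), d ≤ m ^ c ∧
            ∃ (K₀ : Matrix (Fin d) (Fin d) (AlgebraicClosure (ZMod p)))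
              (K : Fin g.1 → Matrix (Fin d) (Fin d) (AlgebraicClosure (ZMod p))),
              ∀ v : Fin g.1 → Bool, g.2 v = true ↔ θ ≤ (symbolicMatrix K₀ K v).rank}) →
        C.size ≤ m ^ c → ¬ C.Computes (cliqueFn m ⌈(m : ℝ) ^ δ⌉₊) := by
  rw [cliqueExtLowerBound_iff]
  simp only [LowerBoundAt, extGate_eq_algClosure_zmod]

/-- Registered sub-goal `grankGate_iff_algClosureZMod` of the line skeleton (lead c11): GRANK gates of the crux
basis are exactly the GRANK gates over the fields `AlgebraicClosure (ZMod p)`, `p` prime. [folklore] -/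
theorem grankGate_iff_algClosureZMod : ∀ (s : ℕ) (g : GateFn), IsGRankGate s g ↔
    ∃ (p : ℕ) (_ : Fact p.Prime) (d θ : ℕ), d ≤ s ∧
      ∃ (K₀ : Matrix (Fin d) (Fin d) (AlgebraicClosure (ZMod p)))
        (K : Fin g.1 → Matrix (Fin d) (Fin d) (AlgebraicClosure (ZMod p))),
        ∀ v : Fin g.1 → Bool, g.2 v = true ↔ θ ≤ (symbolicMatrix K₀ K v).rank :=
  fun _ _ => isGRankGate_iff_algClosure_zmod

end Summit.PneNP.PneNP.Theorems.CliqueExtLowerBound.GRankPrimeField
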